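import Literature.Topology.FourManifolds.PresentationHandlebodyFive
import Literature.Topology.FourManifolds.KnotsProofs
import Literature.Topology.FourManifolds.NeckCapping
import Literature.Topology.FourManifolds.HCobordismIdealCircleProofs
import Literature.Topology.FourManifolds.SmoothEmbeddingCriteria
import Literature.Topology.FourManifolds.ImmersionCriterion
import Literature.Topology.FourManifolds.KnotFraming
import HarnessLib

/-!
# Great spheres of `∂𝔻ⁿ⁺¹` are smoothly embedded in `𝔻ⁿ⁺¹`; the attaching circle of a
# 5-dimensional 2-handle is a smooth embedding

Topic `Literature/Topology/FourManifolds`; brick of the roadmap in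
`PresentationHandlebodyFiveProofs.lean` (the attaching circles of `H⁵(P, ε)` must be *knots* in
`∂V` before Whitney's theorem `exists_smoothIsotopy_link_of_homotopic` can move them), the
5-dimensional counterpart of `Geometry/Symplectic/AttachingCircleProofs.lean` (there the model
circle in `D⁴` was the Legendrian unknot; here a general argument):

* `Literature.Topology.FourManifolds.isSmoothEmbedding_inclusion_comp_sphere_of_linearIsometry`
  — **the restriction to unit spheres of a linear isometry `L : E → ℝⁿ⁺¹` (`dim E = k + 1`),
  followed by the inclusion `𝕊ⁿ ↪ 𝔻ⁿ⁺¹`, is a smooth embedding of the boundaryless `𝕊(E)`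
  into the manifold with boundary `𝔻ⁿ⁺¹`** (model `𝓡∂ (n + 1)`, atlas
  `instChartedSpaceClosedBall` of `ClosedBall.lean`): in the stereographic chart
  `stereographic' k (-p)` and the boundary chart `closedBallBoundaryChart (f p)` of `𝔻ⁿ⁺¹` the map
  reads `w ↦ (0, T w)` for a linear isometry `T : ℝᵏ → ℝⁿ`
  (`exists_linearIsometry_stereographic'_apply_symm`, `KnotsProofs.lean`), i.e. `e (w, 0)` for a
  linear isomorphism `e : ℝᵏ × (ℝⁿ⁻ᵏ × ℝ) ≅ ℝⁿ⁺¹` — the argument of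
  `isSmoothEmbedding_sphereInclusion'_holds` (`ClosedBall.lean`, `k = n`) in every codimension;
* `Literature.Topology.FourManifolds.isSmoothEmbedding_coe_coreTubePt₅`,
  `Literature.Topology.FourManifolds.isSmoothEmbedding_coreTubePt₅` — the model attaching circle
  `θ ↦ (θ, 0, 0, 0) ∈ T ⊆ D⁵` of a 5-dimensional 2-handle is a smooth embedding `𝕊¹ ↪ D⁵`,
  `𝕊¹ ↪ T` (corestriction to Kosinski's open tube `handleTube 4 2`);
* `Literature.Topology.FourManifolds.HandleAttachingMap.isSmoothEmbedding_attachingCircle₅` —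
  **the attaching circle of an attaching map `h̄ : T → M` of a 5-dimensional 2-handle is a smooth
  embedding `𝕊¹ ↪ M`** (post-composition with the open smooth embedding `h̄`,
  `Manifold.IsImmersion.openPartialHomeomorph_comp`);
* `Literature.Topology.FourManifolds.BoundaryData.liftMap`,
  `Literature.Topology.FourManifolds.BoundaryData.isSmoothEmbedding_liftMap` — **a smooth
  embedding into `W` with values in `∂W` lifts to a smooth embedding into the boundary manifold**
  `b.carrier` of a boundary datum `b` (all dimensions; smoothness by descent along the immersion
  `b.incl`, `contMDiff_liftOfRange`, immersivity by the chain rule); in particular the attaching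
  circle of a 5-dimensional 2-handle is a knot `HandleAttachingMap.boundaryCircle₅ b h` in the
  closed 4-manifold `b.carrier` (`isSmoothEmbedding_boundaryCircle₅`), the form required by
  Whitney's theorem.

Everything here is proved; no named facts are introduced.

## References

* J. M. Lee, *Introduction to Smooth Manifolds*, 2nd ed., GTM 218 (2013), Thm. 5.11 with
  Problem 1-11 (`∂𝔹̄ⁿ⁺¹ = 𝕊ⁿ` is an embedded hypersurface), Ch. 5 (embedded submanifolds).
  [Lee2013]
* A. A. Kosinski, *Differential Manifolds* (1993), VI §6 (attaching spheres). [Kosinski1993]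
-/

open scoped Manifold ContDiff Topology
open Set Function Metric Module WithLp

noncomputable section

namespace Literature.Topology.FourManifolds

/-! ### Great spheres of the boundary are smoothly embedded in the closed ball -/

section GreatSphere

variable {E : Type*} [NormedAddCommGroup E] [InnerProductSpace ℝ E] {k n : ℕ}
  [Fact (finrank ℝ E = k + 1)]

/-- **Linear algebra of the boundary chart.**  A linear isomorphism
`e : ℝᵏ × F ≅ ℝⁿ` extends to `ℝᵏ × (F × ℝ) ≅ ℝⁿ⁺¹`, `(w, (a, b)) ↦ (b, e (w, a))` (Mathlib's
boundary charts of `𝔻ⁿ⁺¹` put the normal coordinate first, cf. `sphereInclusionComplementEquiv`).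
[folklore] -/
def boundaryPadEquiv {F : Type*} [NormedAddCommGroup F] [NormedSpace ℝ F]
    (e : (EuclideanSpace ℝ (Fin k) × F) ≃L[ℝ] EuclideanSpace ℝ (Fin n)) :
    (EuclideanSpace ℝ (Fin k) × (F × ℝ)) ≃L[ℝ] EuclideanSpace ℝ (Fin (n + 1)) :=
  ((ContinuousLinearEquiv.prodAssoc ℝ (EuclideanSpace ℝ (Fin k)) F ℝ).symm.trans
    (e.prodCongr (ContinuousLinearEquiv.refl ℝ ℝ))).trans
    (sphereInclusionComplementEquiv n).toContinuousLinearEquiv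

/-- `boundaryPadEquiv e (w, (a, b)) = (b, e (w, a))`. [folklore] -/
theorem boundaryPadEquiv_apply {F : Type*} [NormedAddCommGroup F] [NormedSpace ℝ F]
    (e : (EuclideanSpace ℝ (Fin k) × F) ≃L[ℝ] EuclideanSpace ℝ (Fin n))
    (w : EuclideanSpace ℝ (Fin k)) (a : F) (b : ℝ) :
    boundaryPadEquiv e (w, (a, b)) =
      toLp 2 (Fin.cons b (ofLp (e (w, a))) : Fin (n + 1) → ℝ) := rfl

/-- **A great `k`-sphere of `∂𝔻ⁿ⁺¹ = 𝕊ⁿ` is smoothly embedded in the manifold with boundary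
`𝔻ⁿ⁺¹`.**  Let `L : E →ₗᵢ[ℝ] ℝⁿ⁺¹` be a linear isometry (`dim E = k + 1`) and `f : 𝕊(E) → 𝕊ⁿ`
its restriction to unit spheres.  Then `x ↦ f x ∈ 𝔻ⁿ⁺¹` is a `C^∞` embedding for the models
`𝓡 k` (stereographic atlas) and `𝓡∂ (n + 1)` (atlas `instChartedSpaceClosedBall`): a
topological embedding (an isometry followed by the inclusion), and an immersion at every `p` with
complement `ℝⁿ⁻ᵏ × ℝ`, since in the charts `stereographic' k (-p)` and
`closedBallBoundaryChart (f p)` it reads `w ↦ (1 - ‖f y‖, σ (f y)) = (0, T w) =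
boundaryPadEquiv e (w, 0)` with `T` the linear isometry of
`exists_linearIsometry_stereographic'_apply_symm` and `e (w, 0) = T w`
(`exists_continuousLinearEquiv_prod_of_linearIsometry`).
[cite: Lee2013, Thm. 5.11 with Problem 1-11] -/
theorem isSmoothEmbedding_inclusion_comp_sphere_of_linearIsometry
    (L : E →ₗᵢ[ℝ] EuclideanSpace ℝ (Fin (n + 1)))
    {f : sphere (0 : E) 1 → sphere (0 : EuclideanSpace ℝ (Fin (n + 1))) 1}
    (hf : ∀ x, (f x : EuclideanSpace ℝ (Fin (n + 1))) = L x) :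
    Manifold.IsSmoothEmbedding (𝓡 k) (𝓡∂ (n + 1)) ∞
      (fun x => (Set.inclusion sphere_subset_closedBall (f x) :
        closedBall (0 : EuclideanSpace ℝ (Fin (n + 1))) 1)) := by
  haveI : Fact (finrank ℝ (EuclideanSpace ℝ (Fin (n + 1))) = n + 1) := ⟨finrank_euclideanSpace_fin⟩
  refine ⟨?_, (Topology.IsEmbedding.inclusion sphere_subset_closedBall).comp
    (isometry_sphere_of_linearIsometry L hf).isEmbedding⟩
  refine Manifold.IsImmersionOfComplement.isImmersion
    (F := EuclideanSpace ℝ (Fin (n - k)) × ℝ) fun p => ?_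
  -- the chart expression of `f` between the stereographic charts at `-p`, `-f p`
  have hv' : ((-f p : sphere (0 : EuclideanSpace ℝ (Fin (n + 1))) 1) :
      EuclideanSpace ℝ (Fin (n + 1))) = L ((-p : sphere (0 : E) 1) : E) := by
    rw [coe_neg_sphere, coe_neg_sphere, hf, map_neg]
  obtain ⟨T, hT⟩ :=
    exists_linearIsometry_stereographic'_apply_symm (k := k) (n := n) L hf (-p) (-f p) hv'
  have hkn : k ≤ n := by
    simpa using LinearMap.finrank_le_finrank_of_injective (f := T.toLinearMap) T.injective
  obtain ⟨e, he⟩ := exists_continuousLinearEquiv_prod_of_linearIsometry T (d := n - k)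
    (by simp only [finrank_euclideanSpace_fin]; omega)
  have hpp : f p ≠ -f p := fun h => ne_neg_of_mem_unit_sphere ℝ (f p) h
  refine Manifold.IsImmersionAtOfComplement.mk_of_charts (boundaryPadEquiv e)
    (stereographic' k (-p)) (closedBallBoundaryChart (f p)) ?_ ?_ ?_ ?_ ?_ ?_
  · -- `p ∈ (stereographic' k (-p)).source = {-p}ᶜ`
    simpa using ne_neg_of_mem_unit_sphere ℝ p
  · -- `f p ∈ (closedBallBoundaryChart (f p)).source`
    exact inclusion_mem_closedBallBoundaryChart_source n hpp
  · -- the domain chart is `chartAt p`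
    exact IsManifold.chart_mem_maximalAtlas p
  · -- the codomain chart is in the atlas `instChartedSpaceClosedBall`
    exact IsManifold.subset_maximalAtlas (mem_insert_of_mem _ (mem_range_self _))
  · -- `f` maps `{-p}ᶜ` into the source of the boundary chart at `f p`: `f y ≠ -f p`
    intro y hy
    simp only [stereographic'_source, mem_compl_iff, mem_singleton_iff] at hy
    refine inclusion_mem_closedBallBoundaryChart_source n fun h => hy ?_
    have h' := congrArg (fun z : sphere (0 : EuclideanSpace ℝ (Fin (n + 1))) 1 =>
      (z : EuclideanSpace ℝ (Fin (n + 1)))) h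
    simp only [hf, coe_neg_sphere, ← map_neg] at h'
    exact Subtype.ext (by simpa using L.injective h')
  · -- in these charts the map reads `w ↦ (0, T w) = boundaryPadEquiv e (w, 0)`
    intro w _
    set s : sphere (0 : E) 1 := (stereographic' k (-p)).symm w with hs
    have hsT : stereographic' n (-f p) (f s) = T w := by rw [hs]; exact hT w
    rw [comp_apply, comp_apply, OpenPartialHomeomorph.extend_coe_symm, comp_apply,
      modelWithCornersSelf_coe_symm, id, ← hs, OpenPartialHomeomorph.extend_coe, comp_apply,
      modelWithCornersEuclideanHalfSpace_apply, coe_closedBallBoundaryChart_apply, comp_apply,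
      boundaryPadEquiv_apply]
    have h1 : ‖((Set.inclusion sphere_subset_closedBall (f s) :
        closedBall (0 : EuclideanSpace ℝ (Fin (n + 1))) 1) : EuclideanSpace ℝ (Fin (n + 1)))‖ =
        1 := norm_eq_of_mem_sphere (f s)
    have h2 : radialProjection (f p) ((Set.inclusion sphere_subset_closedBall (f s) :
        closedBall (0 : EuclideanSpace ℝ (Fin (n + 1))) 1) : EuclideanSpace ℝ (Fin (n + 1))) =
        f s := radialProjection_coe_sphere (f p) (f s)
    rw [h1, h2, sub_self, hsT, Prod.fst_zero, Prod.snd_zero, he]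

end GreatSphere

/-! ### The model attaching circle of a 5-dimensional 2-handle -/

section Model

/-- The zero-padding `ℝ² → ℝ⁵` as a linear isometry whose restriction to `𝕊¹` is the model
attaching circle `corePt₅` (`exists_linearIsometry_coe_eq_euclideanInclusion`). [folklore] -/
theorem exists_linearIsometry_corePt₅ :
    ∃ L : EuclideanSpace ℝ (Fin 2) →ₗᵢ[ℝ] EuclideanSpace ℝ (Fin 5),
      ∀ θ : sphere (0 : EuclideanSpace ℝ (Fin 2)) 1, corePt₅ θ = L θ := by
  obtain ⟨L, hL⟩ := exists_linearIsometry_coe_eq_euclideanInclusion (k := 2) (n := 5) (by norm_num)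
  refine ⟨L, fun θ => ?_⟩
  rw [hL]
  ext i
  fin_cases i <;> simp [euclideanInclusion_apply, corePt₅]

/-- The model attaching circle as a map `𝕊¹ → 𝕊⁴` into the boundary sphere. [folklore] -/
def coreSpherePt₅ (θ : sphere (0 : EuclideanSpace ℝ (Fin 2)) 1) :
    sphere (0 : EuclideanSpace ℝ (Fin 5)) 1 :=
  ⟨corePt₅ θ, mem_sphere_zero_iff_norm.2 (norm_corePt₅ θ)⟩

/-- The underlying vector of `coreSpherePt₅ θ`. [folklore] -/
@[simp] theorem coe_coreSpherePt₅ (θ : sphere (0 : EuclideanSpace ℝ (Fin 2)) 1) :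
    (coreSpherePt₅ θ : EuclideanSpace ℝ (Fin 5)) = corePt₅ θ := rfl

/-- The model attaching circle in `D⁵` is the great circle `coreSpherePt₅` included in `D⁵`.
[folklore] -/
theorem coe_coreTubePt₅_eq_inclusion (θ : sphere (0 : EuclideanSpace ℝ (Fin 2)) 1) :
    ((coreTubePt₅ θ : ↥(handleTube 4 2)) : closedBall (0 : EuclideanSpace ℝ (Fin 5)) 1) =
      Set.inclusion sphere_subset_closedBall (coreSpherePt₅ θ) :=
  Subtype.ext rfl

/-- **The model attaching circle is a smooth embedding `𝕊¹ ↪ D⁵`** (a great circle of `∂D⁵`).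
[cite: Lee2013, Thm. 5.11 with Problem 1-11] -/
theorem isSmoothEmbedding_coe_coreTubePt₅ :
    Manifold.IsSmoothEmbedding (𝓡 1) (𝓡∂ (4 + 1)) ∞
      (fun θ : sphere (0 : EuclideanSpace ℝ (Fin 2)) 1 =>
        ((coreTubePt₅ θ : ↥(handleTube 4 2)) : closedBall (0 : EuclideanSpace ℝ (Fin 5)) 1)) := by
  haveI : Fact (finrank ℝ (EuclideanSpace ℝ (Fin 2)) = 1 + 1) := ⟨finrank_euclideanSpace_fin⟩
  obtain ⟨L, hL⟩ := exists_linearIsometry_corePt₅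
  have h := isSmoothEmbedding_inclusion_comp_sphere_of_linearIsometry (k := 1) (n := 4) L
    (f := coreSpherePt₅) (fun θ => by rw [coe_coreSpherePt₅, hL])
  refine (show (fun θ : sphere (0 : EuclideanSpace ℝ (Fin 2)) 1 =>
    ((coreTubePt₅ θ : ↥(handleTube 4 2)) : closedBall (0 : EuclideanSpace ℝ (Fin 5)) 1)) =
      fun θ => Set.inclusion sphere_subset_closedBall (coreSpherePt₅ θ) from
    funext coe_coreTubePt₅_eq_inclusion) ▸ h

/-- **The model attaching circle is a smooth embedding `𝕊¹ ↪ T`** into Kosinski's open tube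
(corestriction to the open submanifold, `Manifold.IsSmoothEmbedding.codRestrict_opens`).
[cite: Kosinski1993, VI §6] -/
theorem isSmoothEmbedding_coreTubePt₅ :
    Manifold.IsSmoothEmbedding (𝓡 1) (𝓡∂ (4 + 1)) ∞
      (coreTubePt₅ : sphere (0 : EuclideanSpace ℝ (Fin 2)) 1 → ↥(handleTube 4 2)) :=
  isSmoothEmbedding_coe_coreTubePt₅.codRestrict_opens (handleTube 4 2) fun θ => (coreTubePt₅ θ).2

end Model

/-! ### The attaching circle of an attaching map -/

namespace HandleAttachingMap

variable {M : Type*} [TopologicalSpace M] [T2Space M] [ChartedSpace (EuclideanHalfSpace (4 + 1)) M]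
  [IsManifold (𝓡∂ (4 + 1)) ∞ M]

/-- **The attaching circle of an attaching map of a 5-dimensional 2-handle is a `C^∞` embedding
`𝕊¹ ↪ M`** (`M` Hausdorff): the model circle is a smooth embedding into `T`
(`isSmoothEmbedding_coreTubePt₅`) and `h̄ : T → M` is an open smooth embedding, post-composition
with which preserves immersions (`Manifold.IsImmersion.openPartialHomeomorph_comp`, the inverse
being smooth on the open range, `contMDiffOn_symm_of_isSmoothEmbedding`); injective and continuous
on the compact circle, it is a closed embedding. [cite: Kosinski1993, VI §6] -/
theorem isSmoothEmbedding_attachingCircle₅ (h : HandleAttachingMap 4 2 M) :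
    Manifold.IsSmoothEmbedding (𝓡 1) (𝓡∂ (4 + 1)) ∞ h.attachingCircle₅ := by
  have ho : Topology.IsOpenEmbedding h.toFun := ⟨h.isSmoothEmbedding.isEmbedding, h.isOpen_range⟩
  haveI : Nonempty ↥(handleTube 4 2) := ⟨coreTubePt₅ (circlePoint 0)⟩
  set Φ := ho.toOpenPartialHomeomorph h.toFun with hΦ
  have hsrc : Φ.source = univ := ho.toOpenPartialHomeomorph_source _
  have hcoe : ⇑Φ = h.toFun := ho.toOpenPartialHomeomorph_apply _
  have hΦsm : ContMDiffOn (𝓡∂ (4 + 1)) (𝓡∂ (4 + 1)) ∞ Φ Φ.source := by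
    rw [hcoe]; exact h.isSmoothEmbedding.contMDiff.contMDiffOn
  have hΦ'sm : ContMDiffOn (𝓡∂ (4 + 1)) (𝓡∂ (4 + 1)) ∞ Φ.symm Φ.target := by
    rw [ho.toOpenPartialHomeomorph_target]
    exact contMDiffOn_symm_of_isSmoothEmbedding h.isSmoothEmbedding ho
  have himm := isSmoothEmbedding_coreTubePt₅.isImmersion.openPartialHomeomorph_comp Φ hΦsm hΦ'sm
    (fun θ => by rw [hsrc]; exact mem_univ _)
  rw [hcoe] at himm
  exact ⟨himm, (h.continuous_attachingCircle₅.isClosedEmbedding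
    h.injective_attachingCircle₅).isEmbedding⟩

end HandleAttachingMap

/-! ### Lifting embeddings with values in `∂W` to the boundary manifold -/

section BoundaryLift

variable {EX HX : Type*} [NormedAddCommGroup EX] [NormedSpace ℝ EX] [TopologicalSpace HX]
  {IX : ModelWithCorners ℝ EX HX} {X : Type*} [TopologicalSpace X] [ChartedSpace HX X]
  {n : ℕ} {W : Type*} [TopologicalSpace W] [ChartedSpace (EuclideanHalfSpace (n + 1)) W]

namespace BoundaryData

/-- **The lift to the boundary manifold** of a map `f : X → W` with values in `∂W`, through
the inclusion `b.incl : b.carrier ≅ ∂W ⊆ W` of a boundary datum (`liftOfRange`,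
`LevelTranslation.lean`). [folklore] -/
def liftMap (b : BoundaryData (𝓡∂ (n + 1)) W (𝓡 n)) (f : X → W)
    (hf : ∀ x, (𝓡∂ (n + 1)).IsBoundaryPoint (f x)) : X → b.carrier :=
  liftOfRange b.incl b.injective_incl f fun x => by rw [b.range_incl]; exact hf x

omit [TopologicalSpace X] [ChartedSpace HX X] in
/-- The lift followed by the inclusion is the map. [folklore] -/
@[simp] theorem incl_liftMap (b : BoundaryData (𝓡∂ (n + 1)) W (𝓡 n)) (f : X → W)
    (hf : ∀ x, (𝓡∂ (n + 1)).IsBoundaryPoint (f x)) (x : X) : b.incl (b.liftMap f hf x) = f x :=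
  apply_liftOfRange _ _ _ _ x

omit [TopologicalSpace X] [ChartedSpace HX X] in
/-- The lift followed by the inclusion is the map (function form). [folklore] -/
theorem incl_comp_liftMap (b : BoundaryData (𝓡∂ (n + 1)) W (𝓡 n)) (f : X → W)
    (hf : ∀ x, (𝓡∂ (n + 1)).IsBoundaryPoint (f x)) : b.incl ∘ b.liftMap f hf = f :=
  funext (b.incl_liftMap f hf)

omit [TopologicalSpace X] [ChartedSpace HX X] in
/-- The lift of an injective map is injective. [folklore] -/
theorem injective_liftMap (b : BoundaryData (𝓡∂ (n + 1)) W (𝓡 n)) {f : X → W}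
    (hf : ∀ x, (𝓡∂ (n + 1)).IsBoundaryPoint (f x)) (hi : Injective f) :
    Injective (b.liftMap f hf) := fun x y h => hi (by
  rw [← b.incl_liftMap f hf x, ← b.incl_liftMap f hf y, h])

/-- **The lift of a smooth map is smooth** (descent along the immersion `b.incl`,
`contMDiff_liftOfRange`). [folklore] -/
theorem contMDiff_liftMap (b : BoundaryData (𝓡∂ (n + 1)) W (𝓡 n)) {f : X → W}
    (hf : ∀ x, (𝓡∂ (n + 1)).IsBoundaryPoint (f x)) (hs : ContMDiff IX (𝓡∂ (n + 1)) ∞ f) :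
    ContMDiff IX (𝓡 n) ∞ (b.liftMap f hf) :=
  contMDiff_liftOfRange b.isSmoothEmbedding _ hs

variable [IX.Boundaryless] [FiniteDimensional ℝ EX] [IsManifold IX ∞ X] [CompactSpace X]
  [T2Space W] [IsManifold (𝓡∂ (n + 1)) ∞ W]

/-- **A smooth embedding of a compact boundaryless manifold into `W` with values in `∂W` lifts
to a smooth embedding into the boundary manifold** `b.carrier`: the lift is smooth
(`contMDiff_liftMap`), injective, and has injective differential by the chain rule
`df = d(incl) ∘ d(lift)` (`Manifold.IsImmersionAtOfComplement.mfderiv_injective`), so the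
immersion criterion for boundaryless manifolds applies
(`isSmoothEmbedding_of_injective_of_injective_mfderiv`).  Lee (2013), Thm. 5.11 (the boundary
is an embedded hypersurface) with Cor. 5.30 (restricting the codomain to an embedded
submanifold). [cite: Lee2013, Thm. 5.11 and Cor. 5.30] -/
theorem isSmoothEmbedding_liftMap (b : BoundaryData (𝓡∂ (n + 1)) W (𝓡 n)) {f : X → W}
    (hf : ∀ x, (𝓡∂ (n + 1)).IsBoundaryPoint (f x))
    (he : Manifold.IsSmoothEmbedding IX (𝓡∂ (n + 1)) ∞ f) :
    Manifold.IsSmoothEmbedding IX (𝓡 n) ∞ (b.liftMap f hf) := by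
  haveI : T2Space b.carrier := b.isSmoothEmbedding.isEmbedding.t2Space
  have hc : ContMDiff IX (𝓡 n) ∞ (b.liftMap f hf) := b.contMDiff_liftMap hf he.contMDiff
  refine isSmoothEmbedding_of_injective_of_injective_mfderiv hc (by simp)
    (b.injective_liftMap hf he.isEmbedding.injective) fun x => ?_
  -- `df_x` is injective (an immersion) and `df_x = d(incl) ∘ d(lift)_x`
  obtain ⟨F, _, _, hF⟩ := he.isImmersion
  have hfx : Injective (mfderiv IX (𝓡∂ (n + 1)) f x) :=
    Manifold.IsImmersionAtOfComplement.mfderiv_injective (hF x) (by simp)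
  rw [← b.incl_comp_liftMap f hf, mfderiv_comp x
    (b.isSmoothEmbedding.contMDiff.mdifferentiableAt (by simp)) (hc.mdifferentiableAt (by simp))]
    at hfx
  intro v w hvw
  apply hfx
  show (mfderiv (𝓡 n) (𝓡∂ (n + 1)) b.incl (b.liftMap f hf x)) (mfderiv IX (𝓡 n) (b.liftMap f hf) x v) =
    (mfderiv (𝓡 n) (𝓡∂ (n + 1)) b.incl (b.liftMap f hf x)) (mfderiv IX (𝓡 n) (b.liftMap f hf) x w)
  rw [hvw]

end BoundaryData

end BoundaryLift

/-! ### The attaching circle as a knot in the boundary 4-manifold -/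

namespace HandleAttachingMap

variable {M : Type*} [TopologicalSpace M] [T2Space M] [ChartedSpace (EuclideanHalfSpace (4 + 1)) M]
  [IsManifold (𝓡∂ (4 + 1)) ∞ M]

/-- **The attaching circle of a 5-dimensional 2-handle, lifted to the boundary 4-manifold**
`b.carrier ≅ ∂M` of a boundary datum. [cite: Kosinski1993, VI §6] -/
def boundaryCircle₅ (b : BoundaryData (𝓡∂ (4 + 1)) M (𝓡 4)) (h : HandleAttachingMap 4 2 M) :
    sphere (0 : EuclideanSpace ℝ (Fin 2)) 1 → b.carrier :=
  b.liftMap h.attachingCircle₅ h.isBoundaryPoint_attachingCircle₅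

omit [T2Space M] [IsManifold (𝓡∂ (4 + 1)) ∞ M] in
/-- The lifted attaching circle followed by the inclusion is the attaching circle. [folklore] -/
@[simp] theorem incl_boundaryCircle₅ (b : BoundaryData (𝓡∂ (4 + 1)) M (𝓡 4))
    (h : HandleAttachingMap 4 2 M) (θ : sphere (0 : EuclideanSpace ℝ (Fin 2)) 1) :
    b.incl (h.boundaryCircle₅ b θ) = h.attachingCircle₅ θ :=
  b.incl_liftMap _ _ θ

/-- **The attaching circle of a 5-dimensional 2-handle is a knot in the closed boundary
4-manifold**: a smooth embedding `𝕊¹ ↪ b.carrier` (`isSmoothEmbedding_attachingCircle₅` lifted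
by `BoundaryData.isSmoothEmbedding_liftMap`). [cite: Kosinski1993, VI §6] -/
theorem isSmoothEmbedding_boundaryCircle₅ (b : BoundaryData (𝓡∂ (4 + 1)) M (𝓡 4))
    (h : HandleAttachingMap 4 2 M) :
    Manifold.IsSmoothEmbedding (𝓡 1) (𝓡 4) ∞ (h.boundaryCircle₅ b) :=
  haveI : Fact (finrank ℝ (EuclideanSpace ℝ (Fin 2)) = 1 + 1) := ⟨finrank_euclideanSpace_fin⟩
  b.isSmoothEmbedding_liftMap _ h.isSmoothEmbedding_attachingCircle₅

omit [T2Space M] [IsManifold (𝓡∂ (4 + 1)) ∞ M] in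
/-- Distinct attaching maps with disjoint ranges have disjoint lifted attaching circles.
[folklore] -/
theorem boundaryCircle₅_ne (b : BoundaryData (𝓡∂ (4 + 1)) M (𝓡 4))
    {h h' : HandleAttachingMap 4 2 M} (hd : Disjoint (range h.toFun) (range h'.toFun))
    (θ θ' : sphere (0 : EuclideanSpace ℝ (Fin 2)) 1) :
    h.boundaryCircle₅ b θ ≠ h'.boundaryCircle₅ b θ' := fun he => by
  have he' := congrArg b.incl he
  rw [incl_boundaryCircle₅, incl_boundaryCircle₅] at he'
  exact Set.disjoint_left.1 hd ⟨_, rfl⟩ (he' ▸ ⟨_, rfl⟩ : h.attachingCircle₅ θ ∈ range h'.toFun)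

end HandleAttachingMap

end Literature.Topology.FourManifolds
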